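import Summits.CriticalPhenomena.PercolationContinuityZ3.Theorems.Transplant.SkelFrmBChoiceNums
import Summits.CriticalPhenomena.PercolationContinuityZ3.Theorems.Transplant.SkelFrmBParamsFaceRoomsA
import HarnessLib

/-!
# N2 (frames-only node `SamePDropOfSkeletonFrm₁`, OPEN) params column over `PlanarSkeletonFrm` — (F) value layer, **J19 / R0 SUCCESSOR of
# `SkelFrmBParamsFaceRoomsA`** (lead g12 2026-08-23T08:47:30Z: ONE kit radius in N2's (F) layer, the (S0) kit of record `KS0.R'0`/`KS0.Rlev0`
# (SkelFrmBChoiceNums); the apron kit `KitA`/`KS.RA'`/`KS.RlevA` does not enter N2's (F) column; hp-8 g42's name table 08:54:57Z).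

RULE (hp-8's registry rule): this successor module IMPORTS the original; its radius-free declarations (`nFc_RA`, §Frame) are USED, never re-declared;
only the RA′-cone declarations `RlevA_le_RA'`, `hRlev_RA` are re-stated at the (S0) kit's levels as **`Rlev0_le_R'0`** (`R'0 = Rlev0 + 1`, by `KS0.R'0_eq`)
and **`hRlev_R0`** (`Rlev0 + 4 ≤ 10·s_i`, `Rlev0 + 4 ≤ 3·r_i`). THE ONE NON-MECHANICAL STEP (device (d)): N1 read `RA′ + 3 ≤ s_i` off `gT`'s own floors
(`cells_geTA'`); at `R'0` the cell floor travels as a NAMED HYPOTHESIS — `hRlev_R0` takes the stride floor of its axis `hsR0 : 6·R'0 + 11 ≤ s_i`, and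
`hRlev_R0_of_box` takes the box floor `hMR0 : 4·K·(R'0+2) ≤ M_L (gT mk gx)` (stmt-g21's residual `22000·Kq·(R'0+2) ≤ gxQ ≤ M_L` dominates it) via
`KS.sA_ge_of_floor'`.
builds on p205010 (kernel theorem, internal audit signed; external expert review pending) — nothing in this file uses p205010; NOTHING is
claimed about the open node `SamePDropOfSkeletonFrm₁`; arithmetic only. The RA′ originals stay in the tree as valid, unused history.
Lane `prim-bschramm-*`, seat `prim-bschramm-p1` (gen 18); helper file (`--supports stmt-CriticalPhenomena-4575 --as helper`).
[cite: KozmaNitzan2024, §4 Lemma 10 Steps II–IV (pp. 18–21)] [cite: MartineauTassion2017, §4.3]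
-/

noncomputable section

open scoped Classical

namespace Summit.CriticalPhenomena.PercolationContinuityZ3.Theorems.Transplant

namespace PlanarSkeletonFrm

namespace NegB

open Literature.Probability.Percolation Literature.Probability.LatticeModels SimpleGraph
open Literature.Probability.Percolation.KozmaNitzan.Cells (oth)
open SkelConc (Consts)
open Skelφ.StepI (DataN)
open Neg

/-! ## Levels vs cells at the (S0) kit (at `g := KS.gT mk gx`) -/

section Rooms

/-- `Rlev0 ≤ R′0` (`R′0 = Rlev0 + 1`) — the `hRl` of `hkF_R0A` at `Rl := Rlev0`; the R′0 successor of `RlevA_le_RA'`. [folklore] -/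
theorem Rlev0_le_R'0 (κ : Consts) {V : Type} [DecidableEq V] [Countable V] {G : SimpleGraph V} [G.LocallyFinite] (Φ : PlanarSkeletonFrm G) (t : V) (p : unitInterval) (D : Skelφ.StepI.DataNS V) (mk : ℕ) :
    KS0.Rlev0 κ Φ t p D mk ≤ KS0.R'0 κ Φ t p D mk := by
  rw [← (KS0.R'0_eq κ Φ t p D mk).2.1]; exact Nat.le_succ _

/-- **Levels of the (S0) kit vs the (ζ′) cells** at `g := gT`, axis `i`, under the stride floor `hsR0 : 6·R'0 + 11 ≤ s_i` (J19 floor-as-hypothesis):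
`Rlev0 + 4 ≤ 10·s_i` and `Rlev0 + 4 ≤ 3·r_i` (hp-8's `hRlev/hRlev'`; `R′0 = Rlev0 + 1`, `r_i = K·s_i`, `K ≥ 40`) — the R′0 successor of `hRlev_RA`. [folklore] -/
theorem hRlev_R0 (κ : Consts) {V : Type} [DecidableEq V] [Countable V] {G : SimpleGraph V} [G.LocallyFinite] (Φ : PlanarSkeletonFrm G) (t : V) (p : unitInterval) (D : Skelφ.StepI.DataNS V) (f : ℕ) (mk : ℕ) (gx : Neg.FSlot)
    (i : Fin 2) (hsR0 : 6 * (KS0.R'0 κ Φ t p D mk : ℤ) + 11 ≤ (((fcellsA κ Φ t p D (KS.gT mk gx κ Φ t p D) f).s i : ℕ) : ℤ)) :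
    KS0.Rlev0 κ Φ t p D mk + 4 ≤ 10 * (fcellsA κ Φ t p D (KS.gT mk gx κ Φ t p D) f).s i ∧ KS0.Rlev0 κ Φ t p D mk + 4 ≤ 3 * (fcellsA κ Φ t p D (KS.gT mk gx κ Φ t p D) f).r i := by
  have hR := (KS0.R'0_eq κ Φ t p D mk).2.1
  have hr := (fcellsA_K κ Φ t p D (KS.gT mk gx κ Φ t p D) f).2.2 i
  have hK := (Neg.forty_le_K κ).1
  have hs : KS0.R'0 κ Φ t p D mk + 3 ≤ (fcellsA κ Φ t p D (KS.gT mk gx κ Φ t p D) f).s i := by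
    have : ((KS0.R'0 κ Φ t p D mk : ℕ) : ℤ) + 3 ≤ (((fcellsA κ Φ t p D (KS.gT mk gx κ Φ t p D) f).s i : ℕ) : ℤ) := by linarith
    exact_mod_cast this
  constructor
  · omega
  · rw [hr]; nlinarith

/-- **Levels vs cells from the BOX FLOOR** `hMR0 : 4·K·(R'0+2) ≤ M_L (gT mk gx)`, both axes (`KS.sA_ge_of_floor'`). [folklore] -/
theorem hRlev_R0_of_box (κ : Consts) {V : Type} [DecidableEq V] [Countable V] {G : SimpleGraph V} [G.LocallyFinite] (Φ : PlanarSkeletonFrm G) (t : V) (p : unitInterval) (D : Skelφ.StepI.DataNS V) (f : ℕ) (mk : ℕ) (gx : Neg.FSlot) (hN : EqNumL κ Φ t p D (KS.gT mk gx κ Φ t p D) f) (hκ : (hL κ Φ t p D (KS.gT mk gx κ Φ t p D) f).natAbs ≤ 10 * nL κ Φ t p D (KS.gT mk gx κ Φ t p D) f)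
    (hMR0 : 4 * Neg.K κ * (KS0.R'0 κ Φ t p D mk + 2) ≤ ML κ Φ t p D (KS.gT mk gx κ Φ t p D)) (i : Fin 2) :
    KS0.Rlev0 κ Φ t p D mk + 4 ≤ 10 * (fcellsA κ Φ t p D (KS.gT mk gx κ Φ t p D) f).s i ∧ KS0.Rlev0 κ Φ t p D mk + 4 ≤ 3 * (fcellsA κ Φ t p D (KS.gT mk gx κ Φ t p D) f).r i := by
  obtain ⟨h0, h1⟩ := KS.sA_ge_of_floor' κ Φ t p D (KS.gT mk gx κ Φ t p D) f hN hκ hMR0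
  have hR : (0 : ℤ) ≤ (KS0.R'0 κ Φ t p D mk : ℤ) := Nat.cast_nonneg _
  refine hRlev_R0 κ Φ t p D f mk gx i ?_
  obtain rfl | rfl : i = 0 ∨ i = 1 := by fin_cases i <;> simp
  · exact h0
  · linarith

end Rooms

end NegB

end PlanarSkeletonFrm

end Summit.CriticalPhenomena.PercolationContinuityZ3.Theorems.Transplant

end
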